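import Summits.Parity.GeneralizedHardyLittlewood.Theorems.PrimeLevelFamEdgeMomentsBeyondDiagonalDiagDecorShiftedP2P2Lpow
import Summits.Parity.GeneralizedHardyLittlewood.Theorems.PrimeLevelFamEdgeMomentsBeyondDiagonalDiagDecorMomentHecke
import Summits.Parity.GeneralizedHardyLittlewood.Theorems.PrimeLevelFamEdgeMomentsBeyondDiagonalDiagDecorWeightGeneric
import HarnessLib

/-!
# Route `PrimeLevelFamEdge`, crux K_A `MomentsBeyondDiagonal` (stmt-Parity-20007), line «petersson_layers» v4, stub `stub_diag`:
# **the GENERIC polynomial-side monomial of EVERY order `(i,j)`: `Sel_M(H_t(k₁)·H_{t′}(k₂)·L^n) = K·log^e M/log²M + O(log^e M/log³M)`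
# whenever `n + t + t′ ≤ e + 1`**

First brick of the generic assembly (G3′) of the census `Cruxes/MomentsBeyondDiagonal/Lines/petersson_layers_stub_diag_g18_generic.md`.
By `…DiagDecorOrderHecke.heckeSum_order_eq i j` every monomial of the order-`(i,j)` weight after the Hecke summation and after the
Bose coefficients are replaced by their polynomial parts is `coef · H_t(k₁)·H_{t′}(k₂)·L^n`, `H_t(k) = Σ_{d∣k}(2log d − log k)^t`,
`L = 2λlog M − 2log g − log k₁ − log k₂`, with `n + t + t′ ≤ i + j + 1`. This file packages ALL such monomials in ONE uniform shape
(the one consumed by `…DiagDecorOrderTargetNormalize.orderTarget_of_selbergAsymptotic` at `M = q̂^{Δ′}`, `e = i + j`):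

* `asymp_pack` / `asymp_pack_of_bound` — bookkeeping: an engine asymptotic `A·log^{m+1}M/log^sM + O(log^mM/log^sM)` (`m + 3 ≤ e + s`),
  resp. a crude bound `O(log^p M)` (`p + 3 ≤ e`), IS of the shape `K·log^eM/log²M + O(log^eM/log³M)` (`K = A` at the top degree, else `K = 0`);
* `exists_selbergHeckeHecke_Lpow_asymp` — **for all `t, t′, n, e` with `n + t + t′ ≤ e + 1`, all `P` with `P₀ = P₁ = 0`, all `λ ∈ [0,1]`:
  `∃ K C, ∀ M ≥ 3, |Sel_M(H_t(k₁)H_{t′}(k₂)L^n) − K·log^eM/log²M| ≤ C·log^eM/log³M`** — by cases: `t` or `t′` odd ⇒ the form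
  vanishes (`…DiagDecorWeightGeneric.centralMoment_eq_zero_of_odd`); `(t,t′) ∈ {0,2}²` ⇒ the engines `…DiagDecorShiftedLpow.abs_selbergLpow_sub_le`,
  `…ShiftedP2Lpow.abs_selbergP2Lpow_sub_le(')`, `…ShiftedP2P2Lpow.abs_selbergP2P2Lpow_sub_le` (`H₀ = τ`, `H₂ = τP₂` on squarefree `k`,
  `…DiagDecorWeightOneOne.selbergForm_congr_squarefree`); a side of degree `≥ 4` ⇒ the crude families `…DiagDecorMomentHecke.abs_selbergHeckeTau_Lpow_le`
  / `abs_selbergTauHecke_Lpow_le` / `abs_selbergHeckeHecke_Lpow_le` (famedge-1 g18).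

Def-free; theorems only. Helper `--supports stmt-Parity-20007`; closes nothing; K_A, K_B and the Parity summit are NOT proved;
nothing about Landau–Siegel zeros.

## References
* E. Kowalski, P. Michel, J. VanderKam, J. reine angew. Math. 526 (2000), (23)–(28) pp. 13–15 and Prop. 5.1 p. 18.
  [cite: KowalskiMichelVanderKam2000, (23)–(28) — derivation (monomials of the order-(i,j) diagonal weight)]
-/

noncomputable section

open scoped Real ArithmeticFunction.Moebius
open Finset ArithmeticFunction Polynomial MeasureTheory intervalIntegral

namespace Summit.Parity.GeneralizedHardyLittlewood.Theorems.MomentsBeyondDiagonal.DiagKernel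

open Literature.NumberTheory.LFunctions Literature.NumberTheory.LFunctions.KMV2000

/-! ### Bookkeeping: every engine output has the shape `K·log^eM/log²M + O(log^eM/log³M)` -/

/-- **Packaging an engine asymptotic** `|S(M) − A·log^mM·log M/log^sM| ≤ C·log^mM/log^sM` (`M ≥ 3`) with `m + 3 ≤ e + s` as
`|S(M) − K·log^eM/log²M| ≤ C′·log^eM/log³M` (`K = A` if `m + 3 = e + s`, else `K = 0`). [folklore] -/
theorem asymp_pack {m s e : ℕ} (hmse : m + 3 ≤ e + s) (A : ℝ) {S : ℝ → ℝ}
    (hS : ∃ C : ℝ, 0 < C ∧ ∀ M : ℝ, 3 ≤ M →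
      |S M - A * Real.log M ^ m * Real.log M / Real.log M ^ s| ≤ C * Real.log M ^ m / Real.log M ^ s) :
    ∃ K C : ℝ, ∀ M : ℝ, 3 ≤ M →
      |S M - K * Real.log M ^ e / Real.log M ^ 2| ≤ C * Real.log M ^ e / Real.log M ^ 3 := by
  obtain ⟨C, hC, h⟩ := hS
  by_cases htop : m + 3 = e + s
  · refine ⟨A, C, fun M hM ↦ ?_⟩
    have hL : 1 ≤ Real.log M := Literature.NumberTheory.Sieve.one_le_log_of_three_le hM
    have hL0 : 0 < Real.log M := by linarith
    have h1 : A * Real.log M ^ m * Real.log M / Real.log M ^ s = A * Real.log M ^ e / Real.log M ^ 2 := by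
      rw [div_eq_div_iff (pow_ne_zero _ hL0.ne') (pow_ne_zero _ hL0.ne')]
      have : Real.log M ^ m * Real.log M * Real.log M ^ 2 = Real.log M ^ e * Real.log M ^ s := by
        rw [← pow_succ, ← pow_add, ← pow_add, show m + 1 + 2 = e + s by omega]
      calc A * Real.log M ^ m * Real.log M * Real.log M ^ 2 = A * (Real.log M ^ m * Real.log M * Real.log M ^ 2) := by ring
        _ = A * (Real.log M ^ e * Real.log M ^ s) := by rw [this]
        _ = A * Real.log M ^ e * Real.log M ^ s := by ring
    have h2 : C * Real.log M ^ m / Real.log M ^ s = C * Real.log M ^ e / Real.log M ^ 3 := by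
      rw [div_eq_div_iff (pow_ne_zero _ hL0.ne') (pow_ne_zero _ hL0.ne')]
      have : Real.log M ^ m * Real.log M ^ 3 = Real.log M ^ e * Real.log M ^ s := by
        rw [← pow_add, ← pow_add, show m + 3 = e + s by omega]
      calc C * Real.log M ^ m * Real.log M ^ 3 = C * (Real.log M ^ m * Real.log M ^ 3) := by ring
        _ = C * (Real.log M ^ e * Real.log M ^ s) := by rw [this]
        _ = C * Real.log M ^ e * Real.log M ^ s := by ring
    rw [← h1, ← h2]
    exact h M hM
  · have hlt : m + 4 ≤ e + s := by omega
    refine ⟨0, C + |A|, fun M hM ↦ ?_⟩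
    have hL : 1 ≤ Real.log M := Literature.NumberTheory.Sieve.one_le_log_of_three_le hM
    have hL0 : 0 < Real.log M := by linarith
    have h' := h M hM
    rw [zero_mul, zero_div, sub_zero]
    have hmain : |A * Real.log M ^ m * Real.log M / Real.log M ^ s| ≤ |A| * Real.log M ^ (m + 1) / Real.log M ^ s := by
      rw [abs_div, abs_mul, abs_mul, abs_of_nonneg (pow_nonneg hL0.le _), abs_of_nonneg hL0.le,
        abs_of_nonneg (pow_nonneg hL0.le _), pow_succ]
      exact le_of_eq (by ring)
    have herr : C * Real.log M ^ m / Real.log M ^ s ≤ C * Real.log M ^ (m + 1) / Real.log M ^ s := by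
      apply div_le_div_of_nonneg_right _ (pow_nonneg hL0.le _)
      apply mul_le_mul_of_nonneg_left _ hC.le
      exact pow_le_pow_right₀ hL (by omega)
    have hpow : Real.log M ^ (m + 1) / Real.log M ^ s ≤ Real.log M ^ e / Real.log M ^ 3 := by
      rw [div_le_div_iff₀ (pow_pos hL0 _) (pow_pos hL0 _), ← pow_add, ← pow_add]
      exact pow_le_pow_right₀ hL (by omega)
    calc |S M| = |(S M - A * Real.log M ^ m * Real.log M / Real.log M ^ s) +
          A * Real.log M ^ m * Real.log M / Real.log M ^ s| := by ring_nf
      _ ≤ |S M - A * Real.log M ^ m * Real.log M / Real.log M ^ s| +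
          |A * Real.log M ^ m * Real.log M / Real.log M ^ s| := abs_add_le _ _
      _ ≤ C * Real.log M ^ (m + 1) / Real.log M ^ s + |A| * Real.log M ^ (m + 1) / Real.log M ^ s :=
          add_le_add (h'.trans herr) hmain
      _ = (C + |A|) * (Real.log M ^ (m + 1) / Real.log M ^ s) := by ring
      _ ≤ (C + |A|) * (Real.log M ^ e / Real.log M ^ 3) :=
          mul_le_mul_of_nonneg_left hpow (by positivity)
      _ = (C + |A|) * Real.log M ^ e / Real.log M ^ 3 := by ring

/-- **Packaging a crude bound** `|S(M)| ≤ C·log^pM` (`M ≥ 3`) with `p + 3 ≤ e` as `|S(M) − 0·log^eM/log²M| ≤ C·log^eM/log³M`. [folklore] -/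
theorem asymp_pack_of_bound {p e : ℕ} (hpe : p + 3 ≤ e) {S : ℝ → ℝ}
    (hS : ∃ C : ℝ, 0 < C ∧ ∀ M : ℝ, 3 ≤ M → |S M| ≤ C * Real.log M ^ p) :
    ∃ K C : ℝ, ∀ M : ℝ, 3 ≤ M →
      |S M - K * Real.log M ^ e / Real.log M ^ 2| ≤ C * Real.log M ^ e / Real.log M ^ 3 := by
  obtain ⟨C, hC, h⟩ := hS
  refine ⟨0, C, fun M hM ↦ ?_⟩
  have hL : 1 ≤ Real.log M := Literature.NumberTheory.Sieve.one_le_log_of_three_le hM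
  have hL0 : 0 < Real.log M := by linarith
  rw [zero_mul, zero_div, sub_zero]
  have hpow : Real.log M ^ p ≤ Real.log M ^ e / Real.log M ^ 3 := by
    rw [le_div_iff₀ (pow_pos hL0 _), ← pow_add]
    exact pow_le_pow_right₀ hL hpe
  calc |S M| ≤ C * Real.log M ^ p := h M hM
    _ ≤ C * (Real.log M ^ e / Real.log M ^ 3) := mul_le_mul_of_nonneg_left hpow hC.le
    _ = C * Real.log M ^ e / Real.log M ^ 3 := by ring

/-- The form that vanishes identically: `|0 − 0·X| ≤ 0·Y`. [folklore] -/
theorem asymp_pack_zero {e : ℕ} {S : ℝ → ℝ} (hS : ∀ M : ℝ, 3 ≤ M → S M = 0) :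
    ∃ K C : ℝ, ∀ M : ℝ, 3 ≤ M →
      |S M - K * Real.log M ^ e / Real.log M ^ 2| ≤ C * Real.log M ^ e / Real.log M ^ 3 :=
  ⟨0, 0, fun M hM ↦ by rw [hS M hM]; simp⟩

/-! ### The generic monomial -/

variable (P : ℝ[X])

set_option maxHeartbeats 1600000 in
/-- **The generic polynomial-side monomial of every order**: for all `t, t′, n, e` with `n + t + t′ ≤ e + 1` (`P₀ = P₁ = 0`,
`0 ≤ λ ≤ 1`) there are `K, C` with `|Sel_M(H_t(k₁)·H_{t′}(k₂)·L^n) − K·log^eM/log²M| ≤ C·log^eM/log³M` for all `M ≥ 3`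
(see the module docstring for the case analysis). [cite: KowalskiMichelVanderKam2000, (23)–(28) and Prop. 5.1 — derivation (monomials of the diagonal weight)] -/
theorem exists_selbergHeckeHecke_Lpow_asymp (t t' n e : ℕ) (hnte : n + t + t' ≤ e + 1)
    (hP0 : P.coeff 0 = 0) (hP1 : P.coeff 1 = 0) {lam : ℝ} (hlam0 : 0 ≤ lam) (hlam1 : lam ≤ 1) :
    ∃ K C : ℝ, ∀ M : ℝ, 3 ≤ M →
      |∑ c ∈ Icc 1 ⌊M⌋₊, ∑ g ∈ Icc 1 (⌊M⌋₊ / c), (μ g : ℝ) * c *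
          ∑ k₁ ∈ Icc 1 (⌊M⌋₊ / (c * g)), ∑ k₂ ∈ Icc 1 (⌊M⌋₊ / (c * g)),
            ((μ (c * g * k₁) : ℝ) * ((psi (c * g * k₁))⁻¹ *
                P.eval (Real.log (M / ((c * g * k₁ : ℕ) : ℝ)) / Real.log M))) / ((c * g * k₁ : ℕ) : ℝ) *
              (((μ (c * g * k₂) : ℝ) * ((psi (c * g * k₂))⁻¹ *
                P.eval (Real.log (M / ((c * g * k₂ : ℕ) : ℝ)) / Real.log M))) / ((c * g * k₂ : ℕ) : ℝ)) *
              ((∑ d ∈ k₁.divisors, (2 * Real.log d - Real.log k₁) ^ t) * (∑ d ∈ k₂.divisors, (2 * Real.log d - Real.log k₂) ^ t') *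
                (2 * (lam * Real.log M) - 2 * Real.log g - Real.log k₁ - Real.log k₂) ^ n) -
        K * Real.log M ^ e / Real.log M ^ 2| ≤ C * Real.log M ^ e / Real.log M ^ 3 := by
  -- parity of the decorations
  rcases Nat.even_or_odd t with ht | ht
  swap
  · -- `t` odd: the weight vanishes identically
    refine asymp_pack_zero fun M hM ↦ ?_
    rw [selbergForm_congr_squarefree P M ⌊M⌋₊ (fun c g k₁ k₂ ↦ ((∑ d ∈ k₁.divisors, (2 * Real.log d - Real.log k₁) ^ t) * (∑ d ∈ k₂.divisors, (2 * Real.log d - Real.log k₂) ^ t') *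
                (2 * (lam * Real.log M) - 2 * Real.log g - Real.log k₁ - Real.log k₂) ^ n))
      (fun c g k₁ k₂ ↦ (0 : ℝ) * ((∑ d ∈ k₂.divisors, (2 * Real.log d - Real.log k₂) ^ t') * (2 * (lam * Real.log M) - 2 * Real.log g - Real.log k₁ - Real.log k₂) ^ n)) fun c g k₁ k₂ _ _ ↦ by
        rw [centralMoment_eq_zero_of_odd ht k₁]; ring]
    rw [selbergProd_const_mul P M 0 (fun c g k₁ k₂ ↦ (∑ d ∈ k₂.divisors, (2 * Real.log d - Real.log k₂) ^ t') * (2 * (lam * Real.log M) - 2 * Real.log g - Real.log k₁ - Real.log k₂) ^ n), zero_mul]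
  rcases Nat.even_or_odd t' with ht' | ht'
  swap
  · -- `t′` odd
    refine asymp_pack_zero fun M hM ↦ ?_
    rw [selbergForm_congr_squarefree P M ⌊M⌋₊ (fun c g k₁ k₂ ↦ ((∑ d ∈ k₁.divisors, (2 * Real.log d - Real.log k₁) ^ t) * (∑ d ∈ k₂.divisors, (2 * Real.log d - Real.log k₂) ^ t') *
                (2 * (lam * Real.log M) - 2 * Real.log g - Real.log k₁ - Real.log k₂) ^ n))
      (fun c g k₁ k₂ ↦ (0 : ℝ) * ((∑ d ∈ k₁.divisors, (2 * Real.log d - Real.log k₁) ^ t) * (2 * (lam * Real.log M) - 2 * Real.log g - Real.log k₁ - Real.log k₂) ^ n)) fun c g k₁ k₂ _ _ ↦ by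
        rw [centralMoment_eq_zero_of_odd ht' k₂]; ring]
    rw [selbergProd_const_mul P M 0 (fun c g k₁ k₂ ↦ (∑ d ∈ k₁.divisors, (2 * Real.log d - Real.log k₁) ^ t) * (2 * (lam * Real.log M) - 2 * Real.log g - Real.log k₁ - Real.log k₂) ^ n), zero_mul]
  -- both even: `t = 0`, `t = 2` or `t ≥ 4`, and the same for `t′`
  have ht_cases : t = 0 ∨ t = 2 ∨ 4 ≤ t := by obtain ⟨a, ha⟩ := ht; omega
  have ht'_cases : t' = 0 ∨ t' = 2 ∨ 4 ≤ t' := by obtain ⟨a, ha⟩ := ht'; omega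
  rcases ht_cases with rfl | rfl | ht4 <;> rcases ht'_cases with rfl | rfl | ht'4
  · -- (0,0): `ττL^n`, engine `abs_selbergLpow_sub_le`, `s = 4`
    obtain ⟨C, hC, hE⟩ := abs_selbergLpow_sub_le P hP0 hP1 n hlam0 hlam1
    refine asymp_pack (m := n) (s := 4) (e := e) (by omega) ((π ^ 2 / 6) ^ 2 * (∑ j ∈ Finset.range (n + 1), ∑ i ∈ Finset.range (j + 1),
            (n.choose j : ℝ) * (j.choose i : ℝ) * 2 ^ (n - j) *
              ∫ u in (0 : ℝ)..1, (((Polynomial.C lam - X) ^ (n - j) * derivative (derivative (X ^ i * P))) *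
                derivative (derivative (X ^ (j - i) * P))).eval u))
      (S := fun M ↦ ∑ c ∈ Icc 1 ⌊M⌋₊, ∑ g ∈ Icc 1 (⌊M⌋₊ / c), (μ g : ℝ) * c *
            ∑ k₁ ∈ Icc 1 (⌊M⌋₊ / (c * g)), ∑ k₂ ∈ Icc 1 (⌊M⌋₊ / (c * g)),
              ((μ (c * g * k₁) : ℝ) * ((psi (c * g * k₁))⁻¹ *
                  P.eval (Real.log (M / ((c * g * k₁ : ℕ) : ℝ)) / Real.log M))) / ((c * g * k₁ : ℕ) : ℝ) *
                (((μ (c * g * k₂) : ℝ) * ((psi (c * g * k₂))⁻¹ *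
                  P.eval (Real.log (M / ((c * g * k₂ : ℕ) : ℝ)) / Real.log M))) / ((c * g * k₂ : ℕ) : ℝ)) *
                ((∑ d ∈ k₁.divisors, (2 * Real.log d - Real.log k₁) ^ 0) * (∑ d ∈ k₂.divisors, (2 * Real.log d - Real.log k₂) ^ 0) *
                (2 * (lam * Real.log M) - 2 * Real.log g - Real.log k₁ - Real.log k₂) ^ n)) ⟨C, hC, fun M hM ↦ ?_⟩
    rw [selbergForm_congr_squarefree P M ⌊M⌋₊ (fun c g k₁ k₂ ↦ ((∑ d ∈ k₁.divisors, (2 * Real.log d - Real.log k₁) ^ 0) * (∑ d ∈ k₂.divisors, (2 * Real.log d - Real.log k₂) ^ 0) *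
                (2 * (lam * Real.log M) - 2 * Real.log g - Real.log k₁ - Real.log k₂) ^ n)) (fun c g k₁ k₂ ↦ ((k₁.divisors.card : ℝ) * (k₂.divisors.card : ℝ) * (2 * (lam * Real.log M) - 2 * Real.log g - Real.log k₁ - Real.log k₂) ^ n))
      fun c g k₁ k₂ _ _ ↦ by rw [centralMoment_zero, centralMoment_zero]]
    exact hE M hM
  · -- (0,2): engine `abs_selbergP2Lpow_sub_le'`, `s = 2`
    obtain ⟨C, hC, hE⟩ := abs_selbergP2Lpow_sub_le' P hP0 hP1 n hlam0 hlam1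
    refine asymp_pack (m := n) (s := 2) (e := e) (by omega) ((π ^ 2 / 6) ^ 2 * (∑ j ∈ Finset.range (n + 1), ∑ i ∈ Finset.range (j + 1),
            (n.choose j : ℝ) * (j.choose i : ℝ) * 2 ^ (n - j) *
              ∫ u in (0 : ℝ)..1, (((Polynomial.C lam - X) ^ (n - j) * (-(2 : ℝ) • (X ^ i * P))) *
                derivative (derivative (X ^ (j - i) * P))).eval u))
      (S := fun M ↦ ∑ c ∈ Icc 1 ⌊M⌋₊, ∑ g ∈ Icc 1 (⌊M⌋₊ / c), (μ g : ℝ) * c *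
            ∑ k₁ ∈ Icc 1 (⌊M⌋₊ / (c * g)), ∑ k₂ ∈ Icc 1 (⌊M⌋₊ / (c * g)),
              ((μ (c * g * k₁) : ℝ) * ((psi (c * g * k₁))⁻¹ *
                  P.eval (Real.log (M / ((c * g * k₁ : ℕ) : ℝ)) / Real.log M))) / ((c * g * k₁ : ℕ) : ℝ) *
                (((μ (c * g * k₂) : ℝ) * ((psi (c * g * k₂))⁻¹ *
                  P.eval (Real.log (M / ((c * g * k₂ : ℕ) : ℝ)) / Real.log M))) / ((c * g * k₂ : ℕ) : ℝ)) *
                ((∑ d ∈ k₁.divisors, (2 * Real.log d - Real.log k₁) ^ 0) * (∑ d ∈ k₂.divisors, (2 * Real.log d - Real.log k₂) ^ 2) *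
                (2 * (lam * Real.log M) - 2 * Real.log g - Real.log k₁ - Real.log k₂) ^ n)) ⟨C, hC, fun M hM ↦ ?_⟩
    rw [selbergForm_congr_squarefree P M ⌊M⌋₊ (fun c g k₁ k₂ ↦ ((∑ d ∈ k₁.divisors, (2 * Real.log d - Real.log k₁) ^ 0) * (∑ d ∈ k₂.divisors, (2 * Real.log d - Real.log k₂) ^ 2) *
                (2 * (lam * Real.log M) - 2 * Real.log g - Real.log k₁ - Real.log k₂) ^ n)) (fun c g k₁ k₂ ↦ ((k₁.divisors.card : ℝ) * ((k₂.divisors.card : ℝ) * (∑ p ∈ k₂.primeFactors, Real.log p ^ 2)) * (2 * (lam * Real.log M) - 2 * Real.log g - Real.log k₁ - Real.log k₂) ^ n))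
      fun c g k₁ k₂ _ hk₂ ↦ by rw [centralMoment_zero, centralMoment_two_of_squarefree hk₂]]
    exact hE M hM
  · -- (0, ≥4): crude `abs_selbergTauHecke_Lpow_le`
    obtain ⟨C, hC, hE⟩ := abs_selbergTauHecke_Lpow_le P t' hP0 hP1 n hlam0 hlam1
    refine asymp_pack_of_bound (p := n) (e := e) (by omega)
      (S := fun M ↦ ∑ c ∈ Icc 1 ⌊M⌋₊, ∑ g ∈ Icc 1 (⌊M⌋₊ / c), (μ g : ℝ) * c *
            ∑ k₁ ∈ Icc 1 (⌊M⌋₊ / (c * g)), ∑ k₂ ∈ Icc 1 (⌊M⌋₊ / (c * g)),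
              ((μ (c * g * k₁) : ℝ) * ((psi (c * g * k₁))⁻¹ *
                  P.eval (Real.log (M / ((c * g * k₁ : ℕ) : ℝ)) / Real.log M))) / ((c * g * k₁ : ℕ) : ℝ) *
                (((μ (c * g * k₂) : ℝ) * ((psi (c * g * k₂))⁻¹ *
                  P.eval (Real.log (M / ((c * g * k₂ : ℕ) : ℝ)) / Real.log M))) / ((c * g * k₂ : ℕ) : ℝ)) *
                ((∑ d ∈ k₁.divisors, (2 * Real.log d - Real.log k₁) ^ 0) * (∑ d ∈ k₂.divisors, (2 * Real.log d - Real.log k₂) ^ t') *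
                (2 * (lam * Real.log M) - 2 * Real.log g - Real.log k₁ - Real.log k₂) ^ n)) ⟨C, hC, fun M hM ↦ ?_⟩
    rw [selbergForm_congr_squarefree P M ⌊M⌋₊ (fun c g k₁ k₂ ↦ ((∑ d ∈ k₁.divisors, (2 * Real.log d - Real.log k₁) ^ 0) * (∑ d ∈ k₂.divisors, (2 * Real.log d - Real.log k₂) ^ t') *
                (2 * (lam * Real.log M) - 2 * Real.log g - Real.log k₁ - Real.log k₂) ^ n)) (fun c g k₁ k₂ ↦ ((k₁.divisors.card : ℝ) * (∑ d ∈ k₂.divisors, (2 * Real.log d - Real.log k₂) ^ t') * (2 * (lam * Real.log M) - 2 * Real.log g - Real.log k₁ - Real.log k₂) ^ n))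
      fun c g k₁ k₂ _ _ ↦ by rw [centralMoment_zero]]
    exact hE M hM
  · -- (2,0): engine `abs_selbergP2Lpow_sub_le`, `s = 2`
    obtain ⟨C, hC, hE⟩ := abs_selbergP2Lpow_sub_le P hP0 hP1 n hlam0 hlam1
    refine asymp_pack (m := n) (s := 2) (e := e) (by omega) ((π ^ 2 / 6) ^ 2 * (∑ j ∈ Finset.range (n + 1), ∑ i ∈ Finset.range (j + 1),
            (n.choose j : ℝ) * (j.choose i : ℝ) * 2 ^ (n - j) *
              ∫ u in (0 : ℝ)..1, (((Polynomial.C lam - X) ^ (n - j) * (-(2 : ℝ) • (X ^ i * P))) *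
                derivative (derivative (X ^ (j - i) * P))).eval u))
      (S := fun M ↦ ∑ c ∈ Icc 1 ⌊M⌋₊, ∑ g ∈ Icc 1 (⌊M⌋₊ / c), (μ g : ℝ) * c *
            ∑ k₁ ∈ Icc 1 (⌊M⌋₊ / (c * g)), ∑ k₂ ∈ Icc 1 (⌊M⌋₊ / (c * g)),
              ((μ (c * g * k₁) : ℝ) * ((psi (c * g * k₁))⁻¹ *
                  P.eval (Real.log (M / ((c * g * k₁ : ℕ) : ℝ)) / Real.log M))) / ((c * g * k₁ : ℕ) : ℝ) *
                (((μ (c * g * k₂) : ℝ) * ((psi (c * g * k₂))⁻¹ *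
                  P.eval (Real.log (M / ((c * g * k₂ : ℕ) : ℝ)) / Real.log M))) / ((c * g * k₂ : ℕ) : ℝ)) *
                ((∑ d ∈ k₁.divisors, (2 * Real.log d - Real.log k₁) ^ 2) * (∑ d ∈ k₂.divisors, (2 * Real.log d - Real.log k₂) ^ 0) *
                (2 * (lam * Real.log M) - 2 * Real.log g - Real.log k₁ - Real.log k₂) ^ n)) ⟨C, hC, fun M hM ↦ ?_⟩
    rw [selbergForm_congr_squarefree P M ⌊M⌋₊ (fun c g k₁ k₂ ↦ ((∑ d ∈ k₁.divisors, (2 * Real.log d - Real.log k₁) ^ 2) * (∑ d ∈ k₂.divisors, (2 * Real.log d - Real.log k₂) ^ 0) *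
                (2 * (lam * Real.log M) - 2 * Real.log g - Real.log k₁ - Real.log k₂) ^ n)) (fun c g k₁ k₂ ↦ ((k₁.divisors.card : ℝ) * (∑ p ∈ k₁.primeFactors, Real.log p ^ 2) * (k₂.divisors.card : ℝ) * (2 * (lam * Real.log M) - 2 * Real.log g - Real.log k₁ - Real.log k₂) ^ n))
      fun c g k₁ k₂ hk₁ _ ↦ by rw [centralMoment_zero, centralMoment_two_of_squarefree hk₁]]
    exact hE M hM
  · -- (2,2): engine `abs_selbergP2P2Lpow_sub_le`, `s = 0`
    obtain ⟨C, hC, hE⟩ := abs_selbergP2P2Lpow_sub_le P hP0 hP1 n hlam0 hlam1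
    refine asymp_pack (m := n) (s := 0) (e := e) (by omega) ((π ^ 2 / 6) ^ 2 * (∑ j ∈ Finset.range (n + 1), ∑ i ∈ Finset.range (j + 1),
            (n.choose j : ℝ) * (j.choose i : ℝ) * 2 ^ (n - j) *
              ∫ u in (0 : ℝ)..1, (((Polynomial.C lam - X) ^ (n - j) * (-(2 : ℝ) • (X ^ i * P))) *
                (-(2 : ℝ) • (X ^ (j - i) * P))).eval u))
      (S := fun M ↦ ∑ c ∈ Icc 1 ⌊M⌋₊, ∑ g ∈ Icc 1 (⌊M⌋₊ / c), (μ g : ℝ) * c *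
            ∑ k₁ ∈ Icc 1 (⌊M⌋₊ / (c * g)), ∑ k₂ ∈ Icc 1 (⌊M⌋₊ / (c * g)),
              ((μ (c * g * k₁) : ℝ) * ((psi (c * g * k₁))⁻¹ *
                  P.eval (Real.log (M / ((c * g * k₁ : ℕ) : ℝ)) / Real.log M))) / ((c * g * k₁ : ℕ) : ℝ) *
                (((μ (c * g * k₂) : ℝ) * ((psi (c * g * k₂))⁻¹ *
                  P.eval (Real.log (M / ((c * g * k₂ : ℕ) : ℝ)) / Real.log M))) / ((c * g * k₂ : ℕ) : ℝ)) *
                ((∑ d ∈ k₁.divisors, (2 * Real.log d - Real.log k₁) ^ 2) * (∑ d ∈ k₂.divisors, (2 * Real.log d - Real.log k₂) ^ 2) *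
                (2 * (lam * Real.log M) - 2 * Real.log g - Real.log k₁ - Real.log k₂) ^ n)) ⟨C, hC, fun M hM ↦ ?_⟩
    rw [selbergForm_congr_squarefree P M ⌊M⌋₊ (fun c g k₁ k₂ ↦ ((∑ d ∈ k₁.divisors, (2 * Real.log d - Real.log k₁) ^ 2) * (∑ d ∈ k₂.divisors, (2 * Real.log d - Real.log k₂) ^ 2) *
                (2 * (lam * Real.log M) - 2 * Real.log g - Real.log k₁ - Real.log k₂) ^ n))
      (fun c g k₁ k₂ ↦ ((k₁.divisors.card : ℝ) * (∑ p ∈ k₁.primeFactors, Real.log p ^ 2) * ((k₂.divisors.card : ℝ) * (∑ p ∈ k₂.primeFactors, Real.log p ^ 2)) * (2 * (lam * Real.log M) - 2 * Real.log g - Real.log k₁ - Real.log k₂) ^ n))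
      fun c g k₁ k₂ hk₁ hk₂ ↦ by rw [centralMoment_two_of_squarefree hk₁, centralMoment_two_of_squarefree hk₂]]
    exact hE M hM
  · -- (2, ≥4): crude two-sided `abs_selbergHeckeHecke_Lpow_le`
    obtain ⟨C, hC, hE⟩ := abs_selbergHeckeHecke_Lpow_le P 2 t' n hlam0 hlam1
    exact asymp_pack_of_bound (p := n + 1) (e := e) (by omega)
      (S := fun M ↦ ∑ c ∈ Icc 1 ⌊M⌋₊, ∑ g ∈ Icc 1 (⌊M⌋₊ / c), (μ g : ℝ) * c *
            ∑ k₁ ∈ Icc 1 (⌊M⌋₊ / (c * g)), ∑ k₂ ∈ Icc 1 (⌊M⌋₊ / (c * g)),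
              ((μ (c * g * k₁) : ℝ) * ((psi (c * g * k₁))⁻¹ *
                  P.eval (Real.log (M / ((c * g * k₁ : ℕ) : ℝ)) / Real.log M))) / ((c * g * k₁ : ℕ) : ℝ) *
                (((μ (c * g * k₂) : ℝ) * ((psi (c * g * k₂))⁻¹ *
                  P.eval (Real.log (M / ((c * g * k₂ : ℕ) : ℝ)) / Real.log M))) / ((c * g * k₂ : ℕ) : ℝ)) *
                ((∑ d ∈ k₁.divisors, (2 * Real.log d - Real.log k₁) ^ 2) * (∑ d ∈ k₂.divisors, (2 * Real.log d - Real.log k₂) ^ t') *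
                (2 * (lam * Real.log M) - 2 * Real.log g - Real.log k₁ - Real.log k₂) ^ n)) ⟨C, hC, fun M hM ↦ hE M hM⟩
  · -- (≥4, 0): crude `abs_selbergHeckeTau_Lpow_le`
    obtain ⟨C, hC, hE⟩ := abs_selbergHeckeTau_Lpow_le P t hP0 hP1 n hlam0 hlam1
    refine asymp_pack_of_bound (p := n) (e := e) (by omega)
      (S := fun M ↦ ∑ c ∈ Icc 1 ⌊M⌋₊, ∑ g ∈ Icc 1 (⌊M⌋₊ / c), (μ g : ℝ) * c *
            ∑ k₁ ∈ Icc 1 (⌊M⌋₊ / (c * g)), ∑ k₂ ∈ Icc 1 (⌊M⌋₊ / (c * g)),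
              ((μ (c * g * k₁) : ℝ) * ((psi (c * g * k₁))⁻¹ *
                  P.eval (Real.log (M / ((c * g * k₁ : ℕ) : ℝ)) / Real.log M))) / ((c * g * k₁ : ℕ) : ℝ) *
                (((μ (c * g * k₂) : ℝ) * ((psi (c * g * k₂))⁻¹ *
                  P.eval (Real.log (M / ((c * g * k₂ : ℕ) : ℝ)) / Real.log M))) / ((c * g * k₂ : ℕ) : ℝ)) *
                ((∑ d ∈ k₁.divisors, (2 * Real.log d - Real.log k₁) ^ t) * (∑ d ∈ k₂.divisors, (2 * Real.log d - Real.log k₂) ^ 0) *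
                (2 * (lam * Real.log M) - 2 * Real.log g - Real.log k₁ - Real.log k₂) ^ n)) ⟨C, hC, fun M hM ↦ ?_⟩
    rw [selbergForm_congr_squarefree P M ⌊M⌋₊ (fun c g k₁ k₂ ↦ ((∑ d ∈ k₁.divisors, (2 * Real.log d - Real.log k₁) ^ t) * (∑ d ∈ k₂.divisors, (2 * Real.log d - Real.log k₂) ^ 0) *
                (2 * (lam * Real.log M) - 2 * Real.log g - Real.log k₁ - Real.log k₂) ^ n)) (fun c g k₁ k₂ ↦ ((∑ d ∈ k₁.divisors, (2 * Real.log d - Real.log k₁) ^ t) * (k₂.divisors.card : ℝ) * (2 * (lam * Real.log M) - 2 * Real.log g - Real.log k₁ - Real.log k₂) ^ n))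
      fun c g k₁ k₂ _ _ ↦ by rw [centralMoment_zero]]
    exact hE M hM
  · -- (≥4, 2): crude two-sided
    obtain ⟨C, hC, hE⟩ := abs_selbergHeckeHecke_Lpow_le P t 2 n hlam0 hlam1
    exact asymp_pack_of_bound (p := n + 1) (e := e) (by omega)
      (S := fun M ↦ ∑ c ∈ Icc 1 ⌊M⌋₊, ∑ g ∈ Icc 1 (⌊M⌋₊ / c), (μ g : ℝ) * c *
            ∑ k₁ ∈ Icc 1 (⌊M⌋₊ / (c * g)), ∑ k₂ ∈ Icc 1 (⌊M⌋₊ / (c * g)),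
              ((μ (c * g * k₁) : ℝ) * ((psi (c * g * k₁))⁻¹ *
                  P.eval (Real.log (M / ((c * g * k₁ : ℕ) : ℝ)) / Real.log M))) / ((c * g * k₁ : ℕ) : ℝ) *
                (((μ (c * g * k₂) : ℝ) * ((psi (c * g * k₂))⁻¹ *
                  P.eval (Real.log (M / ((c * g * k₂ : ℕ) : ℝ)) / Real.log M))) / ((c * g * k₂ : ℕ) : ℝ)) *
                ((∑ d ∈ k₁.divisors, (2 * Real.log d - Real.log k₁) ^ t) * (∑ d ∈ k₂.divisors, (2 * Real.log d - Real.log k₂) ^ 2) *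
                (2 * (lam * Real.log M) - 2 * Real.log g - Real.log k₁ - Real.log k₂) ^ n)) ⟨C, hC, fun M hM ↦ hE M hM⟩
  · -- (≥4, ≥4): crude two-sided
    obtain ⟨C, hC, hE⟩ := abs_selbergHeckeHecke_Lpow_le P t t' n hlam0 hlam1
    exact asymp_pack_of_bound (p := n + 1) (e := e) (by omega)
      (S := fun M ↦ ∑ c ∈ Icc 1 ⌊M⌋₊, ∑ g ∈ Icc 1 (⌊M⌋₊ / c), (μ g : ℝ) * c *
            ∑ k₁ ∈ Icc 1 (⌊M⌋₊ / (c * g)), ∑ k₂ ∈ Icc 1 (⌊M⌋₊ / (c * g)),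
              ((μ (c * g * k₁) : ℝ) * ((psi (c * g * k₁))⁻¹ *
                  P.eval (Real.log (M / ((c * g * k₁ : ℕ) : ℝ)) / Real.log M))) / ((c * g * k₁ : ℕ) : ℝ) *
                (((μ (c * g * k₂) : ℝ) * ((psi (c * g * k₂))⁻¹ *
                  P.eval (Real.log (M / ((c * g * k₂ : ℕ) : ℝ)) / Real.log M))) / ((c * g * k₂ : ℕ) : ℝ)) *
                ((∑ d ∈ k₁.divisors, (2 * Real.log d - Real.log k₁) ^ t) * (∑ d ∈ k₂.divisors, (2 * Real.log d - Real.log k₂) ^ t') *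
                (2 * (lam * Real.log M) - 2 * Real.log g - Real.log k₁ - Real.log k₂) ^ n)) ⟨C, hC, fun M hM ↦ hE M hM⟩

end Summit.Parity.GeneralizedHardyLittlewood.Theorems.MomentsBeyondDiagonal.DiagKernel

end
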